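import Literature.Computability.AlgebraicComplexity.ConstantFreeCircuits
import HarnessLib

/-!
# Kabanets–Impagliazzo, Cor. 12: the identity-test instance written by the reduction

First file of the discharge of the reduction fact
`Literature.Computability.AlgebraicComplexity.permanent01Graph_polyExists_preimage_PIT`
(`PermanentGraphNSUBEXP.lean`; Kabanets–Impagliazzo 2003, Lemma 11 and proof of Cor. 12, p. 358:
"guess a poly(n)-size arithmetic circuit `C` computing Perm … testing whether `C` is indeed
computing Perm … by Lemma 11 … evaluate it at a given 0-1 matrix"). The reduction writes ONE
division-free integer circuit in the `n²` variables `x_{ab} ↦ a·n + b` in which every guessed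
gate list for `per_{i-1}` is used `i + 1` times — at the generic matrix and at its minors along
the first row (Lemma 11, identity (2)) — and whose output is the running sum of squares

  `(Q₀ − 1)² + Σ_{i=1}^{n} (Qᵢ − Σ_{j<i} x_{0j} · Q_{i−1}(minorⱼ))² + (Qₙ(M) − v)²`,

`Qᵢ` the polynomial of the `i`-th guessed list: the identities (1)–(2) of Lemma 11 (started at
`per₀ = 1`) and the evaluation identity `Qₙ(M) = v` replacing the printed final evaluation. This
file has two parts.

**Part 1 — guessed gate lists behind input layers (block semantics).**
* `KOp`, `KGate`, `KBlock` — the abstract content of a guessed gate list (`ref i` = the `i`-th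
  gate of the use, counted from its input layer; constants `1, -1, 0`; four fan-in-two kinds
  `a + b`, `a − b`, `a · b`, `−a − b`), and its realisation `KGate.toGate base` as gates of the
  tree's `ArithCircuit ℤ τ` at an absolute offset;
* `LayerEntry`, `useGates base L B` — a USE of the block `B` behind an input layer
  `L : Fin N → LayerEntry τ` (a guard gate `0`, then `N` gates holding the layer entries, then the
  block, its references resolved from the guard), `useOut` its output index;
* `blockPoly N B : MvPolynomial (Fin N) ℤ` — the polynomial of the block in its `N` layer inputs,
  and the **use lemma** `valueAt_useGates`: inside any gate list, the output of a use of `B`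
  behind `L` has the value `aeval L.toPoly (blockPoly N B)` — independent of the offset and of the
  surrounding gates (forward references are the junk value `0` of the total semantics everywhere).

**Part 2 — the instance.** `kiCircuit n M v P` is written exactly in the order in which the
reduction machine emits it (level by level, every use behind its own input layer, a running sum
of squares), so that the string-level files only have to show that the machine writes the code
of THIS circuit: the layout functions (`emitUse`, `emitGate`, `closeIdentity`, `level0`,
`minorLoop`, `levelSucc`, `levels`, `finalStep`, `kiCircuit`), the layers (`varEntry`,
`minorLayer`, `constLayer`), the identity polynomials (`Q`, `eZero`, `eLevel`, `eFinal`) and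
**`eval_kiCircuit`**: the circuit computes `accFinal`, the running sum of their squares.
Soundness and completeness are in `KIReductionCorrectness.lean`.

## References

* V. Kabanets, R. Impagliazzo, *Derandomizing polynomial identity tests means proving circuit
  lower bounds*, STOC 2003, Lemma 11 (identities (1), (2)) and proof of Cor. 12 (p. 358).
* P. Bürgisser, *Completeness and Reduction in Algebraic Complexity Theory*, Springer 2000,
  Def. 2.1 (straight-line programs), Rem. 2.7 (substitution) — the tree's `ArithCircuit`,
  `ArithCircuit.substCircuit`, `ArithCircuit.gateValues_append_shift`.
-/


noncomputable section

open MvPolynomial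

namespace Literature.Computability.AlgebraicComplexity

namespace KIReduction

open ArithCircuit

universe u v

variable {τ : Type u}

/-! ### Values inside a gate list -/

/-- The value of gate number `j` of a gate list (junk `0` out of range). [folklore] -/
def valueAt (gs : List (Gate ℤ τ)) (j : ℕ) : MvPolynomial τ ℤ :=
  (gateValues gs).getD j 0

/-- A gate reference reads `valueAt`. [folklore] -/
theorem eval_gate_eq_valueAt (gs : List (Gate ℤ τ)) (j : ℕ) :
    (Operand.gate j : Operand ℤ τ).eval (gateValues gs) = valueAt gs j := rfl

/-- The value list of `gs ++ gs'` extends that of `gs`. [folklore] -/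
theorem gateValues_append_eq (gs gs' : List (Gate ℤ τ)) :
    ∃ ws : List (MvPolynomial τ ℤ), gateValues (gs ++ gs') = gateValues gs ++ ws ∧ ws.length = gs'.length := by
  induction gs' using List.reverseRecOn with
  | nil => exact ⟨[], by simp, rfl⟩
  | append_singleton gs' g ih =>
    obtain ⟨ws, hws, hlen⟩ := ih
    refine ⟨ws ++ [g.eval (gateValues (gs ++ gs'))], ?_, by simp [hlen]⟩
    rw [← List.append_assoc, gateValues_append_singleton, hws, List.append_assoc]

/-- **Prefix stability**: appending gates does not change the values of earlier gates. [folklore] -/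
theorem valueAt_append_left (gs gs' : List (Gate ℤ τ)) {j : ℕ} (hj : j < gs.length) :
    valueAt (gs ++ gs') j = valueAt gs j := by
  obtain ⟨ws, hws, -⟩ := gateValues_append_eq gs gs'
  unfold valueAt
  rw [hws, List.getD_eq_getElem?_getD, List.getD_eq_getElem?_getD,
    List.getElem?_append_left (by simpa using hj)]

/-- The value of the gate just appended. [folklore] -/
theorem valueAt_append_singleton (gs : List (Gate ℤ τ)) (g : Gate ℤ τ) :
    valueAt (gs ++ [g]) gs.length = g.eval (gateValues gs) := by
  unfold valueAt
  rw [gateValues_append_singleton, List.getD_eq_getElem?_getD,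
    List.getElem?_append_right (by simp), gateValues_length, Nat.sub_self]
  simp

/-- A gate reference to an earlier gate, read against any extension of the value list. [folklore] -/
theorem eval_gate_append (gs : List (Gate ℤ τ)) (ws : List (MvPolynomial τ ℤ)) {j : ℕ}
    (hj : j < gs.length) : (Operand.gate j : Operand ℤ τ).eval (gateValues gs ++ ws) = valueAt gs j := by
  simp only [Operand.eval_gate, valueAt, List.getD_eq_getElem?_getD]
  rw [List.getElem?_append_left (by simpa using hj)]

/-! ### The guessed gate lists -/

/-- An operand of a guessed gate: a reference to the `i`-th gate of the current use (counted from
the first layer gate, so `i < N` is an input, `N ≤ i` an earlier gate of the block, anything else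
the junk value `0`), or one of the constants `1`, `-1`, `0`. [cite: KabanetsImpagliazzo2003, proof of Cor. 12 (p. 358)] -/
inductive KOp
  /-- reference to gate `i` of the use -/
  | ref (i : ℕ)
  /-- the constant `1` -/
  | one
  /-- the constant `-1` -/
  | negOne
  /-- the constant `0` -/
  | zero
  deriving DecidableEq

/-- The four kinds of guessed gates: `a + b`, `a − b`, `a · b`, `−a − b` (enough to host every
fan-in-two constant-free circuit gate for gate). [cite: KabanetsImpagliazzo2003, proof of Cor. 12 (p. 358)] -/
inductive KKind
  /-- `a + b` -/
  | add
  /-- `a - b` -/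
  | sub
  /-- `a * b` -/
  | mul
  /-- `-a - b` -/
  | negAdd
  deriving DecidableEq

/-- A guessed gate: a kind and two operands. [cite: KabanetsImpagliazzo2003, proof of Cor. 12 (p. 358)] -/
structure KGate where
  /-- the operation -/
  kind : KKind
  /-- first operand -/
  a : KOp
  /-- second operand -/
  b : KOp
  deriving DecidableEq

/-- A guessed gate list ("block"): the guess for one `per_i`. [cite: KabanetsImpagliazzo2003, proof of Cor. 12 (p. 358)] -/
abbrev KBlock : Type := List KGate

/-- Realisation of an operand when the first layer gate of the use has index `base`. [folklore] -/
def KOp.toOperand (base : ℕ) : KOp → Operand ℤ τ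
  | .ref i => .gate (base + i)
  | .one => .const 1
  | .negOne => .const (-1)
  | .zero => .const 0

/-- Realisation of a guessed gate as a gate of the tree's circuits. [folklore] -/
def KGate.toGate (base : ℕ) (g : KGate) : Gate ℤ τ :=
  match g.kind with
  | .add => .sum [(1, g.a.toOperand base), (1, g.b.toOperand base)]
  | .sub => .sum [(1, g.a.toOperand base), (-1, g.b.toOperand base)]
  | .mul => .prod [g.a.toOperand base, g.b.toOperand base]
  | .negAdd => .sum [(-1, g.a.toOperand base), (-1, g.b.toOperand base)]

/-- Shifting the offset shifts the realised operand. [folklore] -/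
theorem KOp.toOperand_shift (base d : ℕ) (u : KOp) :
    (u.toOperand base : Operand ℤ τ).shift d = u.toOperand (d + base) := by
  cases u with
  | ref i => simp only [KOp.toOperand, Operand.shift]; congr 1; omega
  | one => rfl
  | negOne => rfl
  | zero => rfl

/-- Shifting the offset shifts the realised gate. [folklore] -/
@[simp] theorem KGate.toGate_shift (base d : ℕ) (g : KGate) :
    (g.toGate base : Gate ℤ τ).shift d = g.toGate (d + base) := by
  obtain ⟨kd, a, b⟩ := g
  cases kd <;> simp [KGate.toGate, Gate.shift, KOp.toOperand_shift]

/-- Realised operands contain no variables, so substitution only shifts them. [folklore] -/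
theorem KOp.toOperand_subst {σ : Type v} (ρ : σ → Operand ℤ τ) (base d : ℕ) (u : KOp) :
    (u.toOperand base : Operand ℤ σ).subst ρ d = u.toOperand (d + base) := by
  cases u with
  | ref i => simp only [KOp.toOperand, Operand.subst]; congr 1; omega
  | one => rfl
  | negOne => rfl
  | zero => rfl

/-- Realised gates contain no variables, so substitution only shifts them. [folklore] -/
@[simp] theorem KGate.toGate_subst {σ : Type v} (ρ : σ → Operand ℤ τ) (base d : ℕ) (g : KGate) :
    (g.toGate base : Gate ℤ σ).subst ρ d = g.toGate (d + base) := by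
  obtain ⟨kd, a, b⟩ := g
  cases kd <;> simp [KGate.toGate, Gate.subst, KOp.toOperand_subst]

/-! ### Input layers and uses -/

/-- An entry of an input layer: a variable of the ambient circuit or an integer constant. [folklore] -/
inductive LayerEntry (τ : Type u)
  /-- the variable `X v` -/
  | var (v : τ)
  /-- the constant `c` -/
  | const (c : ℤ)

/-- The operand holding a layer entry. [folklore] -/
def LayerEntry.toOperand : LayerEntry τ → Operand ℤ τ
  | .var v => .var v
  | .const c => .const c

/-- The polynomial of a layer entry. [folklore] -/
def LayerEntry.toPoly : LayerEntry τ → MvPolynomial τ ℤ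
  | .var v => X v
  | .const c => C c

/-- A layer operand evaluates to its polynomial against any value list. [folklore] -/
@[simp] theorem LayerEntry.eval_toOperand (e : LayerEntry τ) (vals : List (MvPolynomial τ ℤ)) :
    e.toOperand.eval vals = e.toPoly := by
  cases e <;> rfl

/-- The gate holding a layer entry (`1 • entry`). [folklore] -/
def layerGate (e : LayerEntry τ) : Gate ℤ τ := .sum [(1, e.toOperand)]

/-- The layer gate computes the entry. [folklore] -/
@[simp] theorem eval_layerGate (e : LayerEntry τ) (vals : List (MvPolynomial τ ℤ)) :
    (layerGate e).eval vals = e.toPoly := by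
  simp [layerGate, Gate.eval]

/-- The guard gate `sum []` computes `0`. [folklore] -/
@[simp] theorem eval_sum_nil (vals : List (MvPolynomial τ ℤ)) : (Gate.sum [] : Gate ℤ τ).eval vals = 0 := by
  simp [Gate.eval]

/-- Layer gates have no gate references: shifting fixes them. [folklore] -/
@[simp] theorem layerGate_shift (e : LayerEntry τ) (d : ℕ) : (layerGate e).shift d = layerGate e := by
  cases e <;> rfl

/-- The empty sum gate is fixed by shifting. [folklore] -/
@[simp] theorem sum_nil_shift (d : ℕ) : (Gate.sum [] : Gate ℤ τ).shift d = Gate.sum [] := rfl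

/-- The empty sum gate is fixed by substitution. [folklore] -/
@[simp] theorem sum_nil_subst {σ : Type v} (ρ : σ → Operand ℤ τ) (d : ℕ) :
    (Gate.sum [] : Gate ℤ σ).subst ρ d = Gate.sum [] := rfl

/-- **A use of the block `B` behind the layer `L`**, to be placed at absolute index `base`: the
guard gate `0` (index `base`), the `N` layer gates (indices `base + 1, …, base + N`), and the
block with `ref i ↦ gate (base + 1 + i)`. [cite: KabanetsImpagliazzo2003, proof of Cor. 12 (p. 358)] -/
def useGates {N : ℕ} (base : ℕ) (L : Fin N → LayerEntry τ) (B : KBlock) : List (Gate ℤ τ) :=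
  Gate.sum [] :: ((List.ofFn fun k => layerGate (L k)) ++ B.map (KGate.toGate (base + 1)))

/-- A use has `1 + N + |B|` gates. [folklore] -/
@[simp] theorem length_useGates {N : ℕ} (base : ℕ) (L : Fin N → LayerEntry τ) (B : KBlock) :
    (useGates base L B).length = N + B.length + 1 := by
  simp only [useGates, List.length_cons, List.length_append, List.length_ofFn, List.length_map]

/-- The (relative) output index of a use: its last gate, i.e. the guard when `N + |B| = 0`. For an
honest block (`toKBlock`, `KIReductionCorrectness.lean`) the last gate is the copy `out + 0` of the
circuit's output appended by the conversion, so the value of a use is read at this fixed position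
whatever the shape of the guessed circuit. [folklore] -/
def useOut (N : ℕ) (B : KBlock) : ℕ := N + B.length

/-- The output index is inside the use. [folklore] -/
theorem useOut_lt (N : ℕ) (B : KBlock) {base : ℕ} (L : Fin N → LayerEntry τ) :
    base + useOut N B < base + (useGates base L B).length := by
  simp [useOut]

/-- Placing a use at `base` is shifting the use placed at `0`. [folklore] -/
theorem useGates_eq_map_shift {N : ℕ} (base : ℕ) (L : Fin N → LayerEntry τ) (B : KBlock) :
    useGates base L B = (useGates 0 L B).map (Gate.shift base) := by
  simp only [useGates, List.map_cons, List.map_append, List.map_ofFn, List.map_map,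
    Function.comp_def, sum_nil_shift, layerGate_shift, KGate.toGate_shift, Nat.zero_add]

/-- The identity layer `k ↦ X k` (inputs = the first `N` ambient variables, in order). [folklore] -/
def idLayer (N : ℕ) : Fin N → LayerEntry (Fin N) := fun k => .var k

/-- A use behind `L` at `0` is the substitution `X k ↦ L k` into the use behind the identity
layer. [cite: Burgisser2000, Rem. 2.7] -/
theorem useGates_eq_map_subst {N : ℕ} (L : Fin N → LayerEntry τ) (B : KBlock) :
    useGates 0 L B = (useGates 0 (idLayer N) B).map (Gate.subst (fun k => (L k).toOperand) 0) := by
  have hl : ∀ k : Fin N, (layerGate (idLayer N k)).subst (fun k => (L k).toOperand) 0 = layerGate (L k) :=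
    fun k => rfl
  simp only [useGates, List.map_cons, List.map_append, List.map_ofFn, List.map_map,
    Function.comp_def, sum_nil_subst, hl, KGate.toGate_subst, Nat.zero_add]

/-! ### The polynomial of a block and the use lemma -/

/-- **The polynomial of a block in its `N` inputs**: the output value of its use behind the
identity layer, placed at `0`. [cite: KabanetsImpagliazzo2003, proof of Cor. 12 (p. 358)] -/
def blockPoly (N : ℕ) (B : KBlock) : MvPolynomial (Fin N) ℤ :=
  valueAt (useGates 0 (idLayer N) B) (useOut N B)

/-- The value list of a use at `0` behind `L` is the substituted value list of the use behind the
identity layer. [cite: Burgisser2000, Rem. 2.7] -/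
theorem gateValues_useGates_zero {N : ℕ} (L : Fin N → LayerEntry τ) (B : KBlock) :
    gateValues (useGates 0 L B) =
      (gateValues (useGates 0 (idLayer N) B)).map (aeval fun k => (L k).toPoly) := by
  rw [useGates_eq_map_subst L B]
  have hρ : ∀ (i : Fin N) (ws : List (MvPolynomial τ ℤ)),
      ((fun k => (L k).toOperand) i).eval (([] : List (MvPolynomial τ ℤ)) ++ ws) = (L i).toPoly :=
    fun i ws => LayerEntry.eval_toOperand _ _
  have h := foldl_subst (k := ℤ) (pre := ([] : List (MvPolynomial τ ℤ))) hρ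
    (useGates 0 (idLayer N) B) []
  simpa [gateValues] using h

/-- The output value of a use at `0` behind `L` is `blockPoly` at the layer polynomials. [cite: Burgisser2000, Rem. 2.7] -/
theorem valueAt_useGates_zero {N : ℕ} (L : Fin N → LayerEntry τ) (B : KBlock) :
    valueAt (useGates 0 L B) (useOut N B) = aeval (fun k => (L k).toPoly) (blockPoly N B) := by
  unfold blockPoly valueAt
  rw [gateValues_useGates_zero, List.getD_eq_getElem?_getD, List.getD_eq_getElem?_getD,
    List.getElem?_map]
  cases (gateValues (useGates 0 (idLayer N) B))[useOut N B]? <;> simp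

/-- **Use lemma.** Inside any gate list, the output of a use of `B` behind `L` placed at its own
position `base = |pre|` has the value `blockPoly N B` taken at the layer polynomials — whatever
precedes or follows the use. [cite: KabanetsImpagliazzo2003, proof of Cor. 12 (p. 358)] -/
theorem valueAt_useGates {N : ℕ} (pre post : List (Gate ℤ τ)) (L : Fin N → LayerEntry τ)
    (B : KBlock) :
    valueAt (pre ++ useGates pre.length L B ++ post) (pre.length + useOut N B) =
      aeval (fun k => (L k).toPoly) (blockPoly N B) := by
  rw [valueAt_append_left _ _ (by simp [useOut]), useGates_eq_map_shift, valueAt,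
    gateValues_append_shift, List.getD_eq_getElem?_getD,
    List.getElem?_append_right (by simp), gateValues_length, Nat.add_sub_cancel_left,
    ← List.getD_eq_getElem?_getD]
  exact valueAt_useGates_zero L B

/-- The use lemma read through a gate reference against any extension of the value list (the
form in which later gates consume the output). [cite: KabanetsImpagliazzo2003, proof of Cor. 12 (p. 358)] -/
theorem eval_ref_useOut {N : ℕ} (pre post : List (Gate ℤ τ)) (L : Fin N → LayerEntry τ)
    (B : KBlock) (ws : List (MvPolynomial τ ℤ)) :
    (Operand.gate (pre.length + useOut N B) : Operand ℤ τ).eval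
        (gateValues (pre ++ useGates pre.length L B ++ post) ++ ws) =
      aeval (fun k => (L k).toPoly) (blockPoly N B) := by
  rw [eval_gate_append _ _ (by simp [useOut]; omega)]
  exact valueAt_useGates pre post L B

/-- Behind the identity layer a block computes `blockPoly` itself. [folklore] -/
theorem aeval_idLayer (N : ℕ) (p : MvPolynomial (Fin N) ℤ) :
    aeval (fun k => (idLayer N k).toPoly) p = p := by
  have : (fun k => (idLayer N k).toPoly) = (X : Fin N → MvPolynomial (Fin N) ℤ) := by
    funext k; rfl
  rw [this, aeval_X_left, AlgHom.id_apply]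

/-! ## Part 2: the instance -/

variable (n : ℕ)

/-! ### Variables and layers -/

/-- The layer entry holding the variable number `k` (`x_{ab}` for `k = a·n + b`); the junk
constant `0` out of range (never emitted). [folklore] -/
def varEntry (k : ℕ) : LayerEntry (Fin (n * n)) :=
  if h : k < n * n then .var ⟨k, h⟩ else .const 0

/-- The identity layer of level uses: input `k` is the variable `k`. [cite: KabanetsImpagliazzo2003, Lemma 11 (p. 358)] -/
def idL : Fin (n * n) → LayerEntry (Fin (n * n)) := idLayer (n * n)

/-- **The minor layer** of level `i`, column `j`: input position `a·n + b` (`a, b < i − 1`) holds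
the entry `(a+1, b')` of the generic matrix, `b' = b` for `b < j` and `b + 1` otherwise — the
`(i−1) × (i−1)` minor of the top-left `i × i` block with row `0` and column `j` deleted
(Kabanets–Impagliazzo 2003, Lemma 11: "`Xⱼ` is the `j`th minor of the matrix `X` along the first
row"); all other positions hold `0`. [cite: KabanetsImpagliazzo2003, Lemma 11 (p. 358)] -/
def minorLayer (i j : ℕ) : Fin (n * n) → LayerEntry (Fin (n * n)) := fun k =>
  if k.val / n < i - 1 ∧ k.val % n < i - 1 then
    varEntry n ((k.val / n + 1) * n + (if k.val % n < j then k.val % n else k.val % n + 1))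
  else .const 0

/-- `0 < n` as soon as `Fin (n * n)` is inhabited. [folklore] -/
theorem pos_of_fin {n : ℕ} (k : Fin (n * n)) : 0 < n := by
  rcases Nat.eq_zero_or_pos n with rfl | h
  · exact absurd k.isLt (by simp)
  · exact h

/-- Row index of input position `k = a·n + b`. [folklore] -/
def finDiv {n : ℕ} (k : Fin (n * n)) : Fin n :=
  ⟨k.val / n, (Nat.div_lt_iff_lt_mul (pos_of_fin k)).2 k.isLt⟩

/-- Column index of input position `k = a·n + b`. [folklore] -/
def finMod {n : ℕ} (k : Fin (n * n)) : Fin n := ⟨k.val % n, Nat.mod_lt _ (pos_of_fin k)⟩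

/-- **The constant layer** of the final use: input position `a·n + b` holds the entry `M a b` of
the input matrix ("evaluate it at a given 0-1 matrix", proof of Cor. 12). [cite: KabanetsImpagliazzo2003, proof of Cor. 12 (p. 358)] -/
def constLayer (M : Fin n → Fin n → ℤ) : Fin (n * n) → LayerEntry (Fin (n * n)) := fun k =>
  .const (M (finDiv k) (finMod k))

/-! ### Emission primitives -/

/-- The gates of the instance, over the `n²` matrix variables. [folklore] -/
abbrev Gates : Type := List (Gate ℤ (Fin (n * n)))

/-- The operands of the instance. [folklore] -/
abbrev Opnd : Type := Operand ℤ (Fin (n * n))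

/-- Emit a use of the block `B` behind the layer `L` at the current end; return the new gate
list and the absolute index of the use's output. [cite: KabanetsImpagliazzo2003, proof of Cor. 12 (p. 358)] -/
def emitUse (gs : Gates n) (L : Fin (n * n) → LayerEntry (Fin (n * n))) (B : KBlock) : Gates n × ℕ :=
  (gs ++ useGates gs.length L B, gs.length + useOut (n * n) B)

/-- Emit one gate at the current end; return the new gate list and its index. [folklore] -/
def emitGate (gs : Gates n) (g : Gate ℤ (Fin (n * n))) : Gates n × ℕ := (gs ++ [g], gs.length)

/-- The emission state between identities: the gates so far and the operand holding the running
sum of squares (`const 0` before the first identity). [folklore] -/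
structure Emit where
  /-- gates emitted so far -/
  gates : Gates n
  /-- operand reading the running sum of squares -/
  acc : Opnd n

/-- Close an identity whose value is read by the operand `d`: emit `d · d` and add it to the
running sum. [cite: KabanetsImpagliazzo2003, proof of Cor. 12 (p. 358)] -/
def closeIdentity (st : Emit n) (d : Opnd n) : Emit n :=
  let r₁ := emitGate n st.gates (.prod [d, d])
  let r₂ := emitGate n r₁.1 (.sum [(1, st.acc), (1, .gate r₁.2)])
  ⟨r₂.1, .gate r₂.2⟩

/-- **Level `0`**: use `P₀` behind the identity layer and the identity `Q₀ − 1 ≡ 0`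
(`per₀ = 1`). [cite: KabanetsImpagliazzo2003, Lemma 11 (1) (p. 358)] -/
def level0 (st : Emit n) (P0 : KBlock) : Emit n :=
  let r₁ := emitUse n st.gates (idL n) P0
  let r₂ := emitGate n r₁.1 (.sum [(1, .gate r₁.2), (-1, .const 1)])
  closeIdentity n ⟨r₂.1, st.acc⟩ (.gate r₂.2)

/-- **The minor loop of level `i`**: rounds `j = 0, …`: use `P_{i−1}` behind the minor layer of
column `j`, multiply by `x_{0j}`, subtract from the running identity operand
(Lemma 11 (2): `pᵢ(X) − Σⱼ x_{1j} p_{i−1}(Xⱼ)`). [cite: KabanetsImpagliazzo2003, Lemma 11 (2) (p. 358)] -/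
def minorLoop (i : ℕ) (Pprev : KBlock) : ℕ → Gates n × Opnd n → Gates n × Opnd n
  | 0, st => st
  | j + 1, st =>
    let r := minorLoop i Pprev j st
    let r₁ := emitUse n r.1 (minorLayer n i j) Pprev
    let r₂ := emitGate n r₁.1 (.prod [(varEntry n j).toOperand, .gate r₁.2])
    let r₃ := emitGate n r₂.1 (.sum [(1, r.2), (-1, .gate r₂.2)])
    (r₃.1, .gate r₃.2)

/-- **Level `i ≥ 1`**: use `Pᵢ` behind the identity layer, run the minor loop with `P_{i−1}` for
`j < i`, close the identity. [cite: KabanetsImpagliazzo2003, Lemma 11 (2) (p. 358)] -/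
def levelSucc (st : Emit n) (i : ℕ) (Pi Pprev : KBlock) : Emit n :=
  let r₁ := emitUse n st.gates (idL n) Pi
  let r₂ := minorLoop n i Pprev i (r₁.1, .gate r₁.2)
  closeIdentity n ⟨r₂.1, st.acc⟩ r₂.2

/-- The state after levels `0, …, i`. [cite: KabanetsImpagliazzo2003, Lemma 11 (p. 358)] -/
def levels (P : ℕ → KBlock) : ℕ → Emit n
  | 0 => level0 n ⟨[], .const 0⟩ (P 0)
  | i + 1 => levelSucc n (levels P i) (i + 1) (P (i + 1)) (P i)

/-- **The evaluation identity**: use `Pₙ` behind the constant layer `M` and the identity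
`Qₙ(M) − v ≡ 0` (replacing "evaluate it at a given 0-1 matrix" of the proof of Cor. 12). [cite: KabanetsImpagliazzo2003, proof of Cor. 12 (p. 358)] -/
def finalStep (st : Emit n) (M : Fin n → Fin n → ℤ) (v : ℤ) (Pn : KBlock) : Emit n :=
  let r₁ := emitUse n st.gates (constLayer n M) Pn
  let r₂ := emitGate n r₁.1 (.sum [(1, .gate r₁.2), (-1, .const v)])
  closeIdentity n ⟨r₂.1, st.acc⟩ (.gate r₂.2)

/-- **The identity-test instance** written by the reduction on input `(M, v)` and guess `P`. [cite: KabanetsImpagliazzo2003, Lemma 11 and proof of Cor. 12 (p. 358)] -/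
def kiCircuit (M : Fin n → Fin n → ℤ) (v : ℤ) (P : ℕ → KBlock) : ArithCircuit ℤ (Fin (n * n)) :=
  let st := finalStep n (levels n P n) M v (P n)
  ⟨st.gates, st.acc⟩

/-! ### The identity polynomials -/

/-- `Qᵢ`: the polynomial of the `i`-th guessed gate list in the `n²` matrix variables. [cite: KabanetsImpagliazzo2003, Lemma 11 (p. 358)] -/
def Q (P : ℕ → KBlock) (i : ℕ) : MvPolynomial (Fin (n * n)) ℤ := blockPoly (n * n) (P i)

/-- The level-`0` identity `Q₀ − 1`. [cite: KabanetsImpagliazzo2003, Lemma 11 (1) (p. 358)] -/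
def eZero (P : ℕ → KBlock) : MvPolynomial (Fin (n * n)) ℤ := Q n P 0 - 1

/-- The `j`-th term `x_{0j} · Q_{i−1}(minorⱼ)` of the level-`i` identity. [cite: KabanetsImpagliazzo2003, Lemma 11 (2) (p. 358)] -/
def minorTerm (P : ℕ → KBlock) (i j : ℕ) : MvPolynomial (Fin (n * n)) ℤ :=
  (varEntry n j).toPoly * aeval (fun k => (minorLayer n i j k).toPoly) (Q n P (i - 1))

/-- The level-`i` identity `Qᵢ − Σ_{j<i} x_{0j} · Q_{i−1}(minorⱼ)` (Lemma 11 (2)). [cite: KabanetsImpagliazzo2003, Lemma 11 (2) (p. 358)] -/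
def eLevel (P : ℕ → KBlock) (i : ℕ) : MvPolynomial (Fin (n * n)) ℤ :=
  Q n P i - (Finset.range i).sum (minorTerm n P i)

/-- The evaluation identity `Qₙ(M) − v`. [cite: KabanetsImpagliazzo2003, proof of Cor. 12 (p. 358)] -/
def eFinal (M : Fin n → Fin n → ℤ) (v : ℤ) (P : ℕ → KBlock) : MvPolynomial (Fin (n * n)) ℤ :=
  aeval (fun k => (constLayer n M k).toPoly) (Q n P n) - C v

/-- The running sum of squares after levels `0, …, i`. [folklore] -/
def accLevels (P : ℕ → KBlock) : ℕ → MvPolynomial (Fin (n * n)) ℤ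
  | 0 => 0 + eZero n P ^ 2
  | i + 1 => accLevels P i + eLevel n P (i + 1) ^ 2

/-- The final running sum of squares: what the instance computes. [folklore] -/
def accFinal (M : Fin n → Fin n → ℤ) (v : ℤ) (P : ℕ → KBlock) : MvPolynomial (Fin (n * n)) ℤ :=
  accLevels n P n + eFinal n M v P ^ 2

/-! ### Semantics of the emission -/

/-- `Reads gs u p`: the operand `u` evaluates to `p` against the value list of every extension of
`gs` (followed by anything) — the form stable under further emission. [folklore] -/
def Reads (gs : Gates n) (u : Opnd n) (p : MvPolynomial (Fin (n * n)) ℤ) : Prop :=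
  ∀ more : Gates n, ∀ ws, u.eval (gateValues (gs ++ more) ++ ws) = p

variable {n}

/-- `Reads` is stable under emission. [folklore] -/
theorem Reads.append {gs : Gates n} {u : Opnd n} {p : MvPolynomial (Fin (n * n)) ℤ}
    (h : Reads n gs u p) (more : Gates n) : Reads n (gs ++ more) u p :=
  fun more' ws => by rw [List.append_assoc]; exact h _ ws

/-- A constant operand reads its constant. [folklore] -/
theorem reads_const (gs : Gates n) (c : ℤ) : Reads n gs (.const c) (C c) := fun _ _ => rfl

/-- The operand `const 0` reads `0`. [folklore] -/
theorem reads_zero (gs : Gates n) : Reads n gs (.const 0) 0 := fun _ _ => by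
  simp [Operand.eval]

/-- A layer operand reads its polynomial. [folklore] -/
theorem reads_layerEntry (gs : Gates n) (e : LayerEntry (Fin (n * n))) : Reads n gs e.toOperand e.toPoly :=
  fun _ _ => LayerEntry.eval_toOperand _ _

/-- The reference to a freshly emitted gate reads the value of that gate. [folklore] -/
theorem reads_emitGate (gs : Gates n) (g : Gate ℤ (Fin (n * n))) :
    Reads n (emitGate n gs g).1 (.gate (emitGate n gs g).2) (g.eval (gateValues gs)) := by
  intro more ws
  show (Operand.gate gs.length : Opnd n).eval (gateValues ((gs ++ [g]) ++ more) ++ ws) = _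
  rw [eval_gate_append _ _ (by simp), valueAt_append_left _ _ (by simp), valueAt_append_singleton]

/-- **The reference to the output of a freshly emitted use reads `blockPoly` at the layer.** [cite: KabanetsImpagliazzo2003, proof of Cor. 12 (p. 358)] -/
theorem reads_emitUse (gs : Gates n) (L : Fin (n * n) → LayerEntry (Fin (n * n))) (B : KBlock) :
    Reads n (emitUse n gs L B).1 (.gate (emitUse n gs L B).2)
      (aeval (fun k => (L k).toPoly) (blockPoly (n * n) B)) := by
  intro more ws
  exact eval_ref_useOut gs more L B ws

/-- Value of a freshly emitted binary sum gate `c • u + c' • u'` in terms of what its operands read. [folklore] -/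
theorem eval_sum_two {gs : Gates n} {u u' : Opnd n} {p p' : MvPolynomial (Fin (n * n)) ℤ}
    (hu : Reads n gs u p) (hu' : Reads n gs u' p') (c c' : ℤ) :
    (Gate.sum [(c, u), (c', u')] : Gate ℤ (Fin (n * n))).eval (gateValues gs) = c • p + c' • p' := by
  have h1 := hu [] []
  have h2 := hu' [] []
  simp only [List.append_nil] at h1 h2
  simp [Gate.eval, h1, h2]

/-- Value of a freshly emitted binary product gate. [folklore] -/
theorem eval_prod_two {gs : Gates n} {u u' : Opnd n} {p p' : MvPolynomial (Fin (n * n)) ℤ}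
    (hu : Reads n gs u p) (hu' : Reads n gs u' p') :
    (Gate.prod [u, u'] : Gate ℤ (Fin (n * n))).eval (gateValues gs) = p * p' := by
  have h1 := hu [] []
  have h2 := hu' [] []
  simp only [List.append_nil] at h1 h2
  simp [Gate.eval, h1, h2]

/-- `emitGate` extends the gate list. [folklore] -/
theorem emitGate_fst (gs : Gates n) (g : Gate ℤ (Fin (n * n))) : (emitGate n gs g).1 = gs ++ [g] := rfl

/-- `emitUse` extends the gate list. [folklore] -/
theorem emitUse_fst (gs : Gates n) (L : Fin (n * n) → LayerEntry (Fin (n * n))) (B : KBlock) :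
    (emitUse n gs L B).1 = gs ++ useGates gs.length L B := rfl

/-- **Closing an identity**: if `acc` reads `A` and `d` reads `e`, afterwards `acc` reads
`A + e²`, and the gate list was extended. [folklore] -/
theorem closeIdentity_spec {st : Emit n} {d : Opnd n} {A e : MvPolynomial (Fin (n * n)) ℤ}
    (hA : Reads n st.gates st.acc A) (hd : Reads n st.gates d e) :
    (∃ more, (closeIdentity n st d).gates = st.gates ++ more) ∧
      Reads n (closeIdentity n st d).gates (closeIdentity n st d).acc (A + e ^ 2) := by
  simp only [closeIdentity]
  refine ⟨⟨[Gate.prod [d, d]] ++ [Gate.sum [(1, st.acc), (1, Operand.gate (emitGate n st.gates (Gate.prod [d, d])).2)]],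
    by simp [emitGate_fst]⟩, ?_⟩
  have h1 : Reads n (emitGate n st.gates (Gate.prod [d, d])).1
      (.gate (emitGate n st.gates (Gate.prod [d, d])).2) (e ^ 2) := by
    have := reads_emitGate st.gates (Gate.prod [d, d])
    rwa [eval_prod_two hd hd, ← pow_two e] at this
  have hA' : Reads n (emitGate n st.gates (Gate.prod [d, d])).1 st.acc A := hA.append _
  have := reads_emitGate (emitGate n st.gates (Gate.prod [d, d])).1
    (Gate.sum [(1, st.acc), (1, Operand.gate (emitGate n st.gates (Gate.prod [d, d])).2)])
  rwa [eval_sum_two hA' h1, one_smul, one_smul] at this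

/-- **Level `0`**: `acc` goes from `A` to `A + (Q₀ − 1)²`. [cite: KabanetsImpagliazzo2003, Lemma 11 (1) (p. 358)] -/
theorem level0_spec {st : Emit n} {A : MvPolynomial (Fin (n * n)) ℤ} (hA : Reads n st.gates st.acc A)
    (P : ℕ → KBlock) :
    (∃ more, (level0 n st (P 0)).gates = st.gates ++ more) ∧
      Reads n (level0 n st (P 0)).gates (level0 n st (P 0)).acc (A + eZero n P ^ 2) := by
  simp only [level0]
  set r₁ := emitUse n st.gates (idL n) (P 0) with hr₁
  set r₂ := emitGate n r₁.1 (.sum [(1, .gate r₁.2), (-1, .const 1)]) with hr₂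
  have h1 : Reads n r₁.1 (.gate r₁.2) (Q n P 0) := by
    have := reads_emitUse st.gates (idL n) (P 0)
    rwa [idL, aeval_idLayer] at this
  have h2 : Reads n r₂.1 (.gate r₂.2) (eZero n P) := by
    have := reads_emitGate r₁.1 (Gate.sum [(1, .gate r₁.2), (-1, .const 1)])
    rwa [eval_sum_two h1 (reads_const _ 1), one_smul, neg_smul, one_smul, map_one,
      ← sub_eq_add_neg] at this
  have hA2 : Reads n r₂.1 st.acc A := by
    rw [hr₂, emitGate_fst, hr₁, emitUse_fst, List.append_assoc]; exact hA.append _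
  obtain ⟨⟨more, hmore⟩, hR⟩ := closeIdentity_spec (st := ⟨r₂.1, st.acc⟩) hA2 h2
  refine ⟨⟨useGates st.gates.length (idL n) (P 0) ++
      [Gate.sum [(1, .gate r₁.2), (-1, .const 1)]] ++ more, ?_⟩, hR⟩
  rw [hmore, hr₂, emitGate_fst, hr₁, emitUse_fst]
  simp

/-- **The minor loop**: after `j` rounds started from an operand reading `q`, the operand reads
`q − Σ_{j'<j} x_{0j'} · Q_{i−1}(minor_{j'})`, and the gate list was extended. [cite: KabanetsImpagliazzo2003, Lemma 11 (2) (p. 358)] -/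
theorem minorLoop_spec (P : ℕ → KBlock) (i : ℕ) {gs : Gates n} {d : Opnd n}
    {q : MvPolynomial (Fin (n * n)) ℤ} (hd : Reads n gs d q) :
    ∀ j : ℕ, (∃ more, (minorLoop n i (P (i - 1)) j (gs, d)).1 = gs ++ more) ∧
      Reads n (minorLoop n i (P (i - 1)) j (gs, d)).1 (minorLoop n i (P (i - 1)) j (gs, d)).2
        (q - (Finset.range j).sum (minorTerm n P i))
  | 0 => ⟨⟨[], by simp [minorLoop]⟩, by simpa [minorLoop] using hd⟩
  | j + 1 => by
    obtain ⟨⟨more, hmore⟩, hR⟩ := minorLoop_spec P i hd j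
    simp only [minorLoop]
    set r := minorLoop n i (P (i - 1)) j (gs, d) with hr
    set r₁ := emitUse n r.1 (minorLayer n i j) (P (i - 1)) with hr₁
    set r₂ := emitGate n r₁.1 (.prod [(varEntry n j).toOperand, .gate r₁.2]) with hr₂
    set r₃ := emitGate n r₂.1 (.sum [(1, r.2), (-1, .gate r₂.2)]) with hr₃
    have h1 : Reads n r₁.1 (.gate r₁.2)
        (aeval (fun k => (minorLayer n i j k).toPoly) (Q n P (i - 1))) :=
      reads_emitUse r.1 (minorLayer n i j) (P (i - 1))
    have h2 : Reads n r₂.1 (.gate r₂.2) (minorTerm n P i j) := by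
      have := reads_emitGate r₁.1 (Gate.prod [(varEntry n j).toOperand, .gate r₁.2])
      rwa [eval_prod_two (reads_layerEntry _ _) h1] at this
    have hR2 : Reads n r₂.1 r.2 (q - (Finset.range j).sum (minorTerm n P i)) := by
      rw [hr₂, emitGate_fst, hr₁, emitUse_fst, List.append_assoc]; exact hR.append _
    have h3 : Reads n r₃.1 (.gate r₃.2) (q - (Finset.range (j + 1)).sum (minorTerm n P i)) := by
      have := reads_emitGate r₂.1 (Gate.sum [(1, r.2), (-1, .gate r₂.2)])
      rw [Finset.sum_range_succ, ← sub_sub]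
      rwa [eval_sum_two hR2 h2, one_smul, neg_smul, one_smul, ← sub_eq_add_neg] at this
    refine ⟨⟨more ++ (useGates r.1.length (minorLayer n i j) (P (i - 1)) ++
      [Gate.prod [(varEntry n j).toOperand, .gate r₁.2]] ++ [Gate.sum [(1, r.2), (-1, .gate r₂.2)]]), ?_⟩, h3⟩
    rw [hr₃, emitGate_fst, hr₂, emitGate_fst, hr₁, emitUse_fst, hmore]
    simp

/-- **Level `i ≥ 1`**: `acc` goes from `A` to `A + (eLevel i)²`. [cite: KabanetsImpagliazzo2003, Lemma 11 (2) (p. 358)] -/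
theorem levelSucc_spec {st : Emit n} {A : MvPolynomial (Fin (n * n)) ℤ} (hA : Reads n st.gates st.acc A)
    (P : ℕ → KBlock) (i : ℕ) :
    (∃ more, (levelSucc n st i (P i) (P (i - 1))).gates = st.gates ++ more) ∧
      Reads n (levelSucc n st i (P i) (P (i - 1))).gates (levelSucc n st i (P i) (P (i - 1))).acc
        (A + eLevel n P i ^ 2) := by
  simp only [levelSucc]
  set r₁ := emitUse n st.gates (idL n) (P i) with hr₁
  have h1 : Reads n r₁.1 (.gate r₁.2) (Q n P i) := by
    have := reads_emitUse st.gates (idL n) (P i)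
    rwa [idL, aeval_idLayer] at this
  obtain ⟨⟨more, hmore⟩, hR⟩ := minorLoop_spec P i h1 i
  set r₂ := minorLoop n i (P (i - 1)) i (r₁.1, .gate r₁.2) with hr₂
  have hA2 : Reads n r₂.1 st.acc A := by
    rw [hmore, hr₁, emitUse_fst, List.append_assoc]; exact hA.append _
  obtain ⟨⟨more', hmore'⟩, hR'⟩ := closeIdentity_spec (st := ⟨r₂.1, st.acc⟩) hA2 hR
  refine ⟨⟨useGates st.gates.length (idL n) (P i) ++ more ++ more', ?_⟩, hR'⟩
  rw [hmore', hmore, hr₁, emitUse_fst]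
  simp

/-- **After levels `0, …, i`** the running operand reads `accLevels i`. [cite: KabanetsImpagliazzo2003, Lemma 11 (p. 358)] -/
theorem levels_spec (P : ℕ → KBlock) :
    ∀ i : ℕ, Reads n (levels n P i).gates (levels n P i).acc (accLevels n P i)
  | 0 => (level0_spec (n := n) (st := ⟨[], .const 0⟩) (reads_zero _) P).2
  | i + 1 => by
    have h := levelSucc_spec (levels_spec P i) P (i + 1)
    simpa [levels, accLevels] using h.2

/-- **After the evaluation identity** the running operand reads `accFinal`. [cite: KabanetsImpagliazzo2003, proof of Cor. 12 (p. 358)] -/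
theorem finalStep_spec (M : Fin n → Fin n → ℤ) (v : ℤ) (P : ℕ → KBlock) :
    Reads n (finalStep n (levels n P n) M v (P n)).gates (finalStep n (levels n P n) M v (P n)).acc
      (accFinal n M v P) := by
  simp only [finalStep]
  set st := levels n P n with hst
  set r₁ := emitUse n st.gates (constLayer n M) (P n) with hr₁
  set r₂ := emitGate n r₁.1 (.sum [(1, .gate r₁.2), (-1, .const v)]) with hr₂
  have h1 : Reads n r₁.1 (.gate r₁.2) (aeval (fun k => (constLayer n M k).toPoly) (Q n P n)) :=
    reads_emitUse st.gates (constLayer n M) (P n)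
  have h2 : Reads n r₂.1 (.gate r₂.2) (eFinal n M v P) := by
    have := reads_emitGate r₁.1 (Gate.sum [(1, .gate r₁.2), (-1, .const v)])
    rwa [eval_sum_two h1 (reads_const _ v), one_smul, neg_smul, one_smul, ← sub_eq_add_neg] at this
  have hA2 : Reads n r₂.1 st.acc (accLevels n P n) := by
    rw [hr₂, emitGate_fst, hr₁, emitUse_fst, List.append_assoc]; exact (levels_spec P n).append _
  exact (closeIdentity_spec (st := ⟨r₂.1, st.acc⟩) hA2 h2).2

/-- **The instance computes the running sum of squares of all identities.** [cite: KabanetsImpagliazzo2003, Lemma 11 and proof of Cor. 12 (p. 358)] -/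
theorem eval_kiCircuit (M : Fin n → Fin n → ℤ) (v : ℤ) (P : ℕ → KBlock) :
    (kiCircuit n M v P).eval = accFinal n M v P := by
  have h := finalStep_spec M v P [] []
  simp only [List.append_nil] at h
  exact h

end KIReduction

end Literature.Computability.AlgebraicComplexity

end
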